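import Literature.Barriers.ResolutionOfSingularities.HSBlindToEdgeRank
import HarnessLib

/-!
# Barrier: arc-sharp (Kolchin) strata are empty at multiplicity prime to `p` — Benito–Piltant–Reguera 2022, Cor. 4.5

`Literature/Barriers/ResolutionOfSingularities/KolchinStrataPrimeToP.lean` — barrier catalogue entry (D-0021) for
the summit `ResolutionOfSingularities`.  TECHNIQUE CLASS, in words: use ARC-SPACE data of Kolchin type — the
points `ζ` of the singular scheme `X` at which `X` is *arc-sharp* (the generic arc of `Reg \overline{\{ζ\}}` is
not a specialization of a generic arc of `Reg X`, i.e. `ζ` contributes a "small" irreducible component to the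
arc space `X_∞`; Kolchin's irreducibility theorem says there are none in characteristic `0`), or the finer
"separably-exceptional" strata read off the residue fields of prime divisors over `ζ` — as a CANONICAL
FOCUSING DATUM: a stratification expected to refine the top multiplicity / Hilbert–Samuel locus and to single
out the points where finer resolution invariants are maximal.  THE PRINTED THEOREM that defeats it wherever
the multiplicity is prime to `p`: "`X` is arc-blunt at `ζ` whenever the multiplicity `m(ζ)` of `X` at `ζ` is
prime to `p`" [cite: BenitoPiltantReguera2022, Cor. 4.5 (p. 15)], a corollary of "Assume that there exists a
generically smooth prime divisor over `ζ`. Then `X` is arc-blunt at `ζ`" [cite: BenitoPiltantReguera2022,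
Thm. 4.4 (p. 14)]; and at CLOSED points over a perfect field `X` is always arc-blunt
[cite: BenitoPiltantReguera2022, proof of Cor. 5.9 (p. 22)].  So on a locus of multiplicity prime to `p` the
arc-sharp strata are EMPTY — the datum is constant — however much finer invariants vary there.  The formal
core PROVED here is the explicit instance on the quintic pinch `X = V(y² − x²z² + x⁵) ⊂ 𝔸³` (the
res-hironaka witness W1, characteristic `3`; `quinticPinch` of `HSBlindToEdgeRank.lean`): multiplicity `2`
(prime to `3`) at every `k`-point of the singular axis `D = V(x,y)` and `f ∈ (x,y)²`; the blow-up of `D`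
computed in a chart — exceptional fibre = two lines `y₁ = ±z` over `D`, strict transform regular along them
off the pinch point (two generically smooth prime divisors over the generic point `η` of `D` with residue
field `κ(η)`: the hypothesis of Thm. 4.4, independently of Cor. 4.5); against the directrix dimension
`e_O = 2 ≠ 1 = e_ξ` at the other `k`-points `ξ` of `D` (`2 ≠ 0`; `hsBlindToEdgeRank_quinticPinch`).
Arc spaces are NOT formalised in the tree: the implications "… ⇒ arc-blunt" are the QUOTED theorems, consumed
as named premises; nothing about arc schemes is asserted in Lean.

## What the source prints (verified on the held text `paper:benito2022-small-irreducible-components-arc-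
spaces-positive-characteristic`, open-access version, its own pagination; chunk files named; the text layer
drops Greek letters and ligatures — `ζ`, `Z := \overline{\{ζ\}}`, "field", "finite" restored by the
transcriber and marked ⟨…⟩ where restored)

* Standing hypothesis (chunk p0018 L5): "Let `k` be a perfect ⟨field⟩". [cite: BenitoPiltantReguera2022, §2 (p. 4)]
* Introduction (chunk p0016 L6–L9, p. 3): "In section 4, we introduce the new terminology
  arc-sharp/arc-blunt. Given a scheme-theoretic point `⟨ζ⟩ ∈ X`, `X` is said to be arc-sharp at `⟨ζ⟩` if
  `⟨ζ⟩` is a generic point of `X`, or if the generic arc in `Reg Z`, `Z := ⟨\overline{\{ζ\}}⟩`, is not a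
  specialization of a generic arc in `Reg X`; otherwise, `X` is said to be arc-blunt at `⟨ζ⟩`." and (chunk
  p0017 L1–L7, p. 4): "we give a simple necessary condition for arc-sharpness in Theorem 4.4: if `X` admits a
  resolution of singularities `⟨π⟩ : Y → X`, then `X` is arc-sharp at `z` only if `⟨π⟩⁻¹(⟨ζ⟩)` has no
  separable point over `k(⟨ζ⟩)`. Since we work without the Resolution assumption, our criterion is formulated
  in terms of prime divisors centered at `z`, see Proposition 4.3 and Theorem 4.4 for a precise formulation.
  An interesting corollary is that `X` is arc-sharp at `z` only if its multiplicity at `⟨ζ⟩` is divisible by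
  `p` (Corollary 4.5)." [cite: BenitoPiltantReguera2022, Introduction (pp. 3–4)]
* Definition 4.1 (chunk p0056 L1–L11, p. 12): "Let `X|k` be a `k`-variety, `⟨ζ⟩ ∈ X` and
  `Z := ⟨\overline{\{ζ\}}⟩ ⊆ X`. We say that `X` is arc-sharp at `⟨ζ⟩` if `Z°_∞ = X°_{i,∞}` for some `i`
  (i.e. `⟨ζ⟩ = ⟨ζ⟩_i`), or if `⟨\overline{Z°_∞}⟩ ⊄ ∪_{i=1}^{c} ⟨\overline{X°_{i,∞}}⟩`. If `X` is not
  arc-sharp at `⟨ζ⟩`, we say that `X` is arc-blunt at `⟨ζ⟩`." (`X_i` the irreducible components of `X`,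
  `Y°_∞` the generic arc / its closure in `Reg Y`); Remark 4.1: "`Z°_∞` is an irreducible component of `X_∞`
  if and only if for every irreducible subvariety `F`, `Z ⊆ F ⊆ X`, `F` is arc-sharp at `⟨ζ⟩`."
  [cite: BenitoPiltantReguera2022, Def. 4.1 and Remark 4.1 (p. 12)]
* Theorem 4.4 (chunk p0099 L5–L7, p. 14), verbatim: "Let `X|k` be a `k`-variety, `⟨ζ⟩ ∈ X` and
  `Z := ⟨\overline{\{ζ\}}⟩ ⊆ X`. Assume that there exists a generically smooth prime divisor over `⟨ζ⟩`.
  Then `X` is arc-blunt at `⟨ζ⟩`." [cite: BenitoPiltantReguera2022, Thm. 4.4 (p. 14)]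
* Corollary 4.5 (chunk p0102 L15–L26, p. 15), verbatim: "Let `X|k` be an irreducible `k`-variety, `⟨ζ⟩ ∈ X`
  and `Z := ⟨\overline{\{ζ\}}⟩ ⊆ X`. Let `C_{Z|X} → Z` be the corresponding normal cone and denote by
  `C₁, …, C_r` those irreducible components of `C_{Z|X}` which map dominantly to `Z`. Let
  `[C_{Z|X}] = m₁[C₁] + ⋯ + m_r[C_r]` be the corresponding fundamental cycle. If there exists `i`,
  `1 ≤ i ≤ r`, such that (`p ∤ m_i` and `C_i` is generically smooth over `k(⟨ζ⟩)`), then `X` is arc-blunt at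
  `⟨ζ⟩`. In particular, `X` is arc-blunt at `⟨ζ⟩` whenever the multiplicity `m(⟨ζ⟩)` of `X` at `⟨ζ⟩` is prime
  to `p`."; end of proof (chunk p0103 L1–L4): "since `p ∤ m₁` by hypothesis, it follows that
  `p ∤ [k(⟨μ⟩) : k(⟨ζ⟩)]`. Thus the extension `k(⟨μ⟩)|k(⟨ζ⟩)` is separable. The conclusion follows from
  theorem 4.4. The last statement follows from the fact `m(⟨ζ⟩) = Σ_{i=1}^{r} m_i deg_P(C_i)`".
  [cite: BenitoPiltantReguera2022, Cor. 4.5 and its proof (p. 15)]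
* Proof of Corollary 5.9 (surfaces; chunk p0133 L2–L3, p. 22): "Note that `X` is arc-blunt at every closed
  point since `k` is a perfect ⟨field⟩". [cite: BenitoPiltantReguera2022, proof of Cor. 5.9 (p. 22)]
* Scope printed by the authors: Question 6.2 (Introduction p. 4; §6 p. 23) — whether the codimension-one
  characterization of arc-sharpness (Thm. 5.5 / Cor. 5.8: sufficient conditions need `p ∣` multiplicity and
  inseparable residue extensions) "is also valid in higher codimension, at least for `p > dim 𝒪_{X,⟨ζ⟩}`";
  Example 6.3 (chunk p0138, p. 24): for `f = y^p + z₁x₁^p + ⋯ + z_nx_n^p`, `n ≥ p`, "`Z := Sing X = {y = x₁ =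
  ⋯ = x_n = 0}` is regular. If `⟨ζ⟩` is the generic point of `Z` and `⟨π⟩ : X′ → X` the blowing up along `Z`,
  then `⟨π⟩⁻¹(⟨ζ⟩)` has no separable point. But `p ≤ dim 𝒪_{X,⟨ζ⟩} = n` and we will next show that `X_∞` is
  irreducible" — divisibility of the multiplicity by `p` is NECESSARY for sharpness, not sufficient.
  [cite: BenitoPiltantReguera2022, Question 6.2 (p. 23), Example 6.3 (p. 24)]

## What is PROVED here (kernel-checked; imports `HSBlindToEdgeRank.lean` for `quinticPinch`, `shiftAxis`,
`axisIdeal` and the directrix rows)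

(§1) `blowupAxisChartX` (`x ↦ x, y ↦ y₁x, z ↦ z`), `quinticStrictTransform` `g = y₁² − z² + x³`;
`blowupAxisChartX_quinticPinch`: `f(x, y₁x, z) = x²·g` (total transform = exceptional divisor with
multiplicity `2` times the strict transform); `quinticStrictTransform_exceptionalFibre`:
`g(0, y₁, z) = (y₁ − z)(y₁ + z)`; `quinticStrictTransform_exceptionalLines`: for every `c : k` the points
`(0, ±c, c)` lie on `g = 0` and `∂g/∂y₁ = ±2c` there.
(§2) `two_coprime_three`; the headline `BenitoPiltantReguera2022_kolchinStrataPrimeToP` (`2 ≠ 0`, `c ≠ 0`):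
(1) multiplicity `2` at `O` and at `ξ_c = (0,0,c)`, `f ∈ (x,y)²`, `Nat.Coprime 2 3`; (2) the chart identity,
the exceptional-fibre factorisation, and at `(0, ±c, c)`: `g = 0`, `∂g/∂y₁ ≠ 0`; (3) `e_O = 3 − τ(ȳ²) = 2`,
`e_{ξ_c} = 3 − τ(ȳ² − c²x̄²) = 1` (from `hsBlindToEdgeRank_quinticPinch`).
READING (the printed theorems as named premises; `k` perfect of characteristic `3`, e.g. `𝔽₃` or its
algebraic closure, where `2 ≠ 0`): (i) at the closed points `O`, `ξ_c` of `D`, `X` is arc-blunt (proof of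
Cor. 5.9; also Cor. 4.5 with `m = 2`, `3 ∤ 2`); (ii) at the generic point `η` of `D` — the only non-closed
point of `Sing X = D` — `m(η) = 2` (`f ∈ 𝔭_D²` gives `≥ 2`, and `m(η) ≤ m(ξ_c) = 2`), prime to `3`, so `X`
is arc-blunt at `η` (Cor. 4.5); independently, the two exceptional lines `y₁ = ±z` of `Bl_D X` are prime
divisors over `η` with residue field `κ(η) = k(z)`, generically inside `Reg X′` (proved: `∂g/∂y₁ ≠ 0` along
them off `O`), hence generically smooth — the hypothesis of Thm. 4.4 verbatim.  CONSEQUENCE: every point of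
`Sing X` is arc-blunt; the arc-sharp stratification of `X` is trivial and cannot distinguish `O` from `ξ_c`,
whereas `e_O = 2 ≠ 1 = e_{ξ_c}` (proved here) and, Summit-side, Hironaka-style résumés differ
(`Inv_O = (3,2,1)`, `Inv_{ξ_c} = (3,1,1,1)`; `…Theorems.InvOrderConvention.inv_axis_lt_inv_origin`,
p461082, cited by name — Literature does not import Summits).

## Application recorded here (cells res-hironaka / pub-rosobs; HONEST FRAMING)

Barrier CANDIDATE B11 «KolchinStrataPrimeToP» of the res-hironaka rescue seed (RESCUE-SEED v0.6 §7d; request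
of the kill-test seat res-L1-k32, 2026-08-27T00:02:19Z; director ruling 00:20:08Z "barrier candidate to §7
(operator harvest)") after the kill test K3.2′, variant (V-b) «Kolchin / separably-exceptional strata»
(door `Summit.…Theses.SharpStrata.SepExcModels`, Summit-side), came back DEAD on W1 (2026-08-27T00:01:23Z;
report `pub/res-hironaka/L/res-L1-k32/KILL-TEST-K3.2prime.md`, sha16 6e80be9dede246fc; ONE batched kit job
j262193, canonical table sha16 c726fcabf329af70, re-run verbatim by a second seat as j262362, MATCH): "X₁
has NO arc-sharp point (multiplicity 2 prime to p = 3, BPR Cor 4.5; independently η blunt by the explicit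
blow-up + Thm 4.4), closed points are blunt, so φ_b and φ_b♯ are constant on X₁ and cannot separate O from
ξ_c — exactly the failure mode of HS in K3.2 (datum equal on the pair while Inv differs)".  The same report
found the variants (V-c) (`H_X`, `e`) and (V-a) (riso-strata) ALIVE on W1 (kernel p473659
`…Theorems.CampaignW32.K32Prime.e_separates_W1`, cited by name).  §1–§2 of this file certify the chart
computation and the multiplicity / directrix rows of that report at Literature level; the verdict words are
the cell's, quoted as provenance — internal computations, not citations.  H. Hironaka's 2017 manuscript is
under adjudication in that cell (D-0012); NOTHING in this file is a claim about it, about its `Inv`, or about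
the existence of resolution of singularities in positive characteristic.  AI-transcribed quotations with
restored glyphs: check the page image before signing anything that depends on the exact wording.
-/

noncomputable section

open MvPolynomial
open Literature.AlgebraicGeometry.Resolution

namespace Literature.Barriers.ResolutionOfSingularities

universe u

variable (k : Type u) [Field k]

/-! ## §1 The blow-up of the singular axis of the quintic pinch `y² − x²z² + x⁵` -/
section AxisBlowup

/-- The `x`-chart of the blow-up of `𝔸³` along the axis `D = V(x, y)`: `x ↦ x`, `y ↦ y₁·x`, `z ↦ z`
(after the substitution the variables are `0 ↦ x` (a local equation of the exceptional divisor),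
`1 ↦ y₁ = y/x`, `2 ↦ z`). [folklore] -/
def blowupAxisChartX : MvPolynomial (Fin 3) k →ₐ[k] MvPolynomial (Fin 3) k :=
  aeval ![X 0, X 1 * X 0, X 2]

/-- The strict transform of the quintic pinch in the `x`-chart: `g = y₁² − z² + x³`. (derived here)
[cite: BenitoPiltantReguera2022, Thm. 4.4 (p. 14)] -/
def quinticStrictTransform : MvPolynomial (Fin 3) k := X 1 ^ 2 - X 2 ^ 2 + X 0 ^ 3

/-- `x ↦ x` in the chart. [folklore] -/
private theorem blowupAxisChartX_X0 : blowupAxisChartX k (X 0) = X 0 := by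
  simp [blowupAxisChartX]

/-- `y ↦ y₁ x` in the chart. [folklore] -/
private theorem blowupAxisChartX_X1 : blowupAxisChartX k (X 1) = X 1 * X 0 := by
  simp [blowupAxisChartX]

/-- `z ↦ z` in the chart. [folklore] -/
private theorem blowupAxisChartX_X2 : blowupAxisChartX k (X 2) = X 2 := by
  simp [blowupAxisChartX]

/-- **Chart identity.** `f(x, y₁x, z) = x² · (y₁² − z² + x³)`: in the `x`-chart of the blow-up of
the axis the total transform of `y² − x²z² + x⁵` is `x²` (exceptional divisor, multiplicity `2` =
the multiplicity of `X` along `D`) times the strict transform `g`. (derived here)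
[cite: BenitoPiltantReguera2022, Thm. 4.4 (p. 14), Cor. 4.5 (p. 15)] -/
theorem blowupAxisChartX_quinticPinch :
    blowupAxisChartX k (quinticPinch k) = X 0 ^ 2 * quinticStrictTransform k := by
  simp only [quinticPinch, quinticStrictTransform, map_add, map_sub, map_mul, map_pow,
    blowupAxisChartX_X0, blowupAxisChartX_X1, blowupAxisChartX_X2]
  ring

/-- **Exceptional fibre.** Restricted to the exceptional divisor `x = 0` the strict transform is
`g(0, y₁, z) = y₁² − z² = (y₁ − z)(y₁ + z)`: over the axis `D ≅ 𝔸¹_z` the exceptional fibre of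
`X′ = Bl_D X → X` is the union of the two lines `y₁ = z` and `y₁ = −z`, each mapping isomorphically
onto `D` — two prime divisors over the generic point `η` of `D` with residue field `k(z) = κ(η)`
(distinct when `2 ≠ 0`). (derived here) [cite: BenitoPiltantReguera2022, Thm. 4.4 (p. 14)] -/
theorem quinticStrictTransform_exceptionalFibre :
    aeval ![(0 : MvPolynomial (Fin 3) k), X 1, X 2] (quinticStrictTransform k) =
      (X 1 - X 2) * (X 1 + X 2) := by
  simp only [quinticStrictTransform, map_add, map_sub, map_pow, aeval_X]
  simp
  ring

/-- The partial derivative `∂g/∂y₁ = 2y₁`. (derived here) [folklore] -/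
private theorem pderiv_one_quinticStrictTransform :
    pderiv 1 (quinticStrictTransform k) = C 2 * X 1 := by
  simp only [quinticStrictTransform, map_add, map_sub]
  rw [pderiv_pow, pderiv_pow, pderiv_pow, pderiv_X, pderiv_X, pderiv_X]
  simp [map_ofNat]

/-- **The two exceptional lines, pointwise, and regularity of `X′` along them off the pinch point.**
For every `c : k` the points `(0, c, c)` and `(0, −c, c)` of the chart lie on the strict transform
`g = 0`, and `∂g/∂y₁` takes the values `2c`, `−2c` there — non-zero for `c ≠ 0` when `2 ≠ 0`: the
strict transform is regular at every point of the two exceptional lines over `D ∖ {O}`, so the two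
prime divisors `y₁ = ±z` over `η` are generically smooth (indeed generically contained in the regular
locus of `X′`, with trivial residue extension over `κ(η) = k(z)`). (derived here)
[cite: BenitoPiltantReguera2022, Thm. 4.4 (p. 14)] -/
theorem quinticStrictTransform_exceptionalLines (c : k) :
    eval ![0, c, c] (quinticStrictTransform k) = 0 ∧ eval ![0, -c, c] (quinticStrictTransform k) = 0 ∧
      eval ![0, c, c] (pderiv 1 (quinticStrictTransform k)) = 2 * c ∧
      eval ![0, -c, c] (pderiv 1 (quinticStrictTransform k)) = -(2 * c) := by
  refine ⟨?_, ?_, ?_, ?_⟩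
  · simp [quinticStrictTransform]
  · simp [quinticStrictTransform]
  · simp [pderiv_one_quinticStrictTransform]
  · simp [pderiv_one_quinticStrictTransform]

end AxisBlowup

/-! ## §2 The barrier -/
section Barrier

/-- `2` is prime to `3`: on the res-hironaka witness W1 (characteristic `3`) the multiplicity `2` of
`X = V(y² − x²z² + x⁵)` at every point of its singular axis is prime to the characteristic, the
numerical hypothesis of [cite: BenitoPiltantReguera2022, Cor. 4.5 (p. 15)]. -/
theorem two_coprime_three : Nat.Coprime 2 3 := by decide

/-- **Barrier (Benito–Piltant–Reguera 2022, Cor. 4.5: no arc-sharp point at multiplicity prime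
to `p`) — the hypotheses certified on the quintic pinch `y² − x²z² + x⁵` over any field with `2 ≠ 0`.**
(1) multiplicity `2` at the pinch point `O` and at `ξ_c = (0,0,c)`, `f ∈ (x,y)²`, and `2` is prime to `3`
— with "X is arc-blunt at `ζ` whenever the multiplicity `m(ζ)` of `X` at `ζ` is prime to `p`"
[cite: BenitoPiltantReguera2022, Cor. 4.5 (p. 15)] (characteristic `3`): NO point of `Sing X = D` is
arc-sharp; (2) the blow-up of the axis `D`, chart `y = y₁x`: `f(x, y₁x, z) = x²·(y₁² − z² + x³)`, exceptional
fibre `(y₁ − z)(y₁ + z) = 0` = two lines over `D`, strict transform regular at `(0, ±c, c)` (`∂/∂y₁ = ±2c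
≠ 0`) — two generically smooth prime divisors over the generic point `η` of `D` with residue field `κ(η)`:
"Assume that there exists a generically smooth prime divisor over `ζ`. Then `X` is arc-blunt at `ζ`"
[cite: BenitoPiltantReguera2022, Thm. 4.4 (p. 14)]; at closed points "X is arc-blunt at every closed point
since `k` is a perfect field" [cite: BenitoPiltantReguera2022, proof of Cor. 5.9 (p. 22)]; (3) yet
`e_O = 3 − τ(ȳ²) = 2 ≠ 1 = 3 − τ(ȳ² − c²x̄²) = e_{ξ_c}` [cite: CossartJannsenSaito2020, Def. 2.26]: the
(empty) arc-sharp stratification is constant on a pair of points that the directrix dimension — and any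
résumé refining it — separates.

Technique class, in prose: arc-space / Kolchin-type stratifications of the singular locus — arc-sharp
points (generic points of "small" irreducible components of `X_∞`), separably-exceptional strata (residue
fields of prime divisors over `ζ` all inseparable over `κ(ζ)`) — used as a canonical focusing or
centre-selection datum expected to refine the top multiplicity / Hilbert–Samuel locus or to locate the maxima
of finer resolution invariants.

BARRIER (D-0021):
- technique_class: arc-space-stratification kolchin-irreducibility arc-sharp-strata small-irreducible-components-of-arc-space separably-exceptional-strata prime-divisor-residue-separability nash-type-arc-data arc-components-as-focus core-focusing-by-arc-data
- blocks: every «the arc-sharp / separably-exceptional stratum refines `Σ^max` (multiplicity, `H_X`) or separates points of different `Inv` / `e`» claim on a locus whose multiplicity is PRIME TO `p`, and every such claim at CLOSED points over a perfect field whatever the multiplicity: there the strata are EMPTY [cite: BenitoPiltantReguera2022, Cor. 4.5 (p. 15), proof of Cor. 5.9 (p. 22)] — certified instance `BenitoPiltantReguera2022_kolchinStrataPrimeToP`: `X = V(y² − x²z² + x⁵)`, characteristic `3`, multiplicity `2` at every point of `Sing X = D = V(x,y)` (proved at all `k`-points and `f ∈ 𝔭_D²`), two generically smooth prime divisors `y₁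 = ±z` over `η` (proved chart computation; Thm. 4.4's hypothesis verbatim), so NO point of `X` is arc-sharp and the datum `φ_b ≡ blunt` is constant on `D`, while `e_O = 2 ≠ 1 = e_{ξ_c}` (proved) and, Summit-side, `Inv_O = (3,2,1) ≠ (3,1,1,1) = Inv_{ξ_c}` (`…Theorems.InvOrderConvention.inv_axis_lt_inv_origin`, cited by name).
- because: a prime divisor over `ζ` whose residue field is separable (generically smooth) over `κ(ζ)` lets the generic arc of `Reg Z` specialise from a generic arc of `Reg X` via local uniformization along formal arcs [cite: BenitoPiltantReguera2022, Thm. 4.4 (p. 14), Prop. 4.3]; if `p ∤ m_i` for a dominant component `C_i` of the normal cone then the residue degree `[k(μ) : k(ζ)]` divides `m_i`, hence is prime to `p`, hence the extension is separable, and `m(ζ) = Σ m_i deg_P(C_i)` makes "multiplicity prime to `p`" sufficient [cite: BenitoPiltantReguera2022, proof of Cor. 4.5 (p. 15)]; at closed points of a variety over a perfect field every prime divisor has a residue field finitely and separably generated over `k` [cite: BenitoPiltantReguera2022, proof of Cor. 5.9 (p. 22)]. Arc-sharpness therefore only sees the `p`-DIVISIBLE part of the multiplicity at NON-closed points — it is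 blind by construction on tame (prime-to-`p`) loci, which is where the quintic pinch (multiplicity `2`, `p = 3`) and every hypersurface of multiplicity `< p` live.
- evasions_known: (i) WILD LOCI ONLY: use arc-sharpness where it has content — non-closed points `ζ` with `p ∣ m(ζ)` and inseparable residue extensions of all prime divisors over `ζ` (codimension one: necessary and sufficient, Thm. 5.5 / Cor. 5.8 / Cor. 5.9 for surfaces; higher codimension: Question 6.2 OPEN, with Example 6.3 `y^p + Σ z_ix_i^p` showing `p ∣ m` is not sufficient) [cite: BenitoPiltantReguera2022, Cor. 5.9 (p. 22), Question 6.2 (p. 23), Example 6.3 (p. 24)] — on the res-hironaka characteristic-`2` witness W2 (multiplicity `2 = p` along eight curves) the sharpened datum `φ_b♯` is recorded UNDECIDED, not dead (K3.2′ report §(V-b), W2 row); (ii) OTHER ARC / JET DATA that do vary on tame loci: Nash multiplicity sequences, jet-scheme dimensions and (in characteristic `0`) log canonical thresholds, motivic / riso-type invariants — the riso-strata variant (V-a) was found ALIVE on W1 by the same kill test; none of these is the Kolchin-sharpness datum blocked here; (iii) PAIR WITH CONE DATA: carry the Hilbert–Samuel function together with the directrix (`H_X`, `e`) [cite: CossartJannsenSaito2020,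 Def. 2.26, Thm. 3.3] — variant (V-c) ALIVE on both K3.2 pairs (Summit-side `CampaignW32.K32Prime.e_separates_W1/_W2`, cited by name); see the sibling entry `Literature.Barriers.ResolutionOfSingularities.Kollar2007_hsBlindToEdgeRank` for what `H_X` alone cannot do on the same germ.
- scope_caveats: (a) the source works with varieties over a PERFECT field `k` of characteristic `p > 0` and scheme points `ζ`; arc spaces, generic arcs, prime divisors and "generically smooth" are NOT formalised in the tree — the statements "… ⇒ arc-blunt" are QUOTED [cite: BenitoPiltantReguera2022, Thm. 4.4 (p. 14), Cor. 4.5 (p. 15)] and consumed as named premises; (b) the kernel content is the polynomial-level surrogate of their HYPOTHESES on one explicit hypersurface: multiplicity at `k`-points = Hauser's `ord₀` of the translate (`= 2` for every `c`, any field), `f ∈ (x,y)²` for the generic point of the axis, `Nat.Coprime 2 3`, the `x`-chart of `Bl_D 𝔸³` with the total/strict transform identity, the exceptional fibre as the product of two linear factors, and the non-vanishing of `∂g/∂y₁` at `(0, ±c, c)` for `c ≠ 0`, `2 ≠ 0` (regularity of the strict transform there); the `y`-chart and the scheme-theoretic identification "exceptional lines = prime divisors over `η` with residue field `k(z)`"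 are read off these identities, not separately formalised; (c) `2 ≠ 0` is used to separate the two exceptional lines and for the directrix row `e_{ξ_c} = 1`; the campaign's field has characteristic `3`; (d) the barrier concerns the Kolchin-SHARPNESS datum only — it says nothing against arc-space methods in general (evasion (ii)), against the codimension-one theory of the source, or about multiplicity divisible by `p`; (e) NOTHING here bears on the existence of resolution of singularities in positive characteristic or on H. Hironaka's 2017 manuscript (under adjudication, D-0012): the res-hironaka rows (K3.2′ (V-b) DEAD, j262193 / j262362, p473659, p461082) are internal computations quoted as provenance.
- status: established — printed theorems quoted with page locators from the held text; formal core §1–§2 proved in the tree (explicit chart computation + the multiplicity / directrix rows of `HSBlindToEdgeRank.lean`); application = res-hironaka K3.2′ variant (V-b) DEAD on W1, report and hashes named in the module docstring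
[cite: BenitoPiltantReguera2022, Def. 4.1 (p. 12), Thm. 4.4 (p. 14), Cor. 4.5 (p. 15), proof of Cor. 5.9 (p. 22)]
[cite: CossartJannsenSaito2020, Def. 2.26, Thm. 3.3] -/
theorem BenitoPiltantReguera2022_kolchinStrataPrimeToP (h2 : (2 : k) ≠ 0) {c : k} (hc : c ≠ 0) :
    -- (1) Cor. 4.5's hypothesis on W1: multiplicity 2 at O, at ξ_c and along D (f ∈ 𝔭_D²),
    --     and 2 is prime to 3
    (Hauser2010.ordZero (shiftAxis k 0 (quinticPinch k)) = 2 ∧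
      Hauser2010.ordZero (shiftAxis k c (quinticPinch k)) = 2 ∧
      quinticPinch k ∈ axisIdeal k ^ 2 ∧ Nat.Coprime 2 3) ∧
    -- (2) Thm. 4.4's hypothesis at η, explicitly: the blow-up of D has exceptional fibre the two
    --     lines y₁ = ±z over D, along which the strict transform is regular off O
    (blowupAxisChartX k (quinticPinch k) = X 0 ^ 2 * quinticStrictTransform k ∧
      aeval ![(0 : MvPolynomial (Fin 3) k), X 1, X 2] (quinticStrictTransform k) =
        (X 1 - X 2) * (X 1 + X 2) ∧
      (eval ![0, c, c] (quinticStrictTransform k) = 0 ∧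
        eval ![0, c, c] (pderiv 1 (quinticStrictTransform k)) ≠ 0) ∧
      (eval ![0, -c, c] (quinticStrictTransform k) = 0 ∧
        eval ![0, -c, c] (pderiv 1 (quinticStrictTransform k)) ≠ 0)) ∧
    -- (3) … while the directrix dimension separates O from ξ_c: e_O = 2 ≠ 1 = e_{ξ_c}
    (3 - hironakaTau k ({X 1 ^ 2} : Set (MvPolynomial (Fin 3) k)) = 2 ∧
      3 - hironakaTau k ({X 1 ^ 2 - C (c ^ 2) * X 0 ^ 2} : Set (MvPolynomial (Fin 3) k)) = 1) := by
  obtain ⟨hmult, -, htau⟩ := hsBlindToEdgeRank_quinticPinch k h2 hc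
  obtain ⟨l1, l2, d1, d2⟩ := quinticStrictTransform_exceptionalLines k c
  have h2c : (2 : k) * c ≠ 0 := mul_ne_zero h2 hc
  refine ⟨⟨hmult.1, hmult.2.1, hmult.2.2, two_coprime_three⟩,
    ⟨blowupAxisChartX_quinticPinch k, quinticStrictTransform_exceptionalFibre k,
      ⟨l1, by rwa [d1]⟩, ⟨l2, by rwa [d2, neg_ne_zero]⟩⟩, htau⟩

end Barrier

end Literature.Barriers.ResolutionOfSingularities
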